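import Literature.Probability.Percolation.MarkedLoopNecessityForm
import Literature.Probability.Percolation.MarkedLoopCornerSideSupport
import HarnessLib

/-!
# A two-corner face functional sees only the pictures through both corners («TWO-CORNER-LAM»)

Topic `Literature/Probability/Percolation`; generic-`k` layer of the marked-loop (Khristoforov–Smirnov) lineage; a rider on `MarkedLoopNecessityForm.lean` («DOOR-U FORM»: the
named face functional `holoLam D v hv : (Pic k → ℂ) →ₗ ℂ`, `holoDefect_eq_holoLam_relMapΦ`, and ★★★ `necessity_iff_holoLam_jointly_injective` — door (U) ⟺ joint injectivity of
the face functionals) and on `MarkedLoopCornerSideSupport.lean` («CORNER-SIDE SUPPORT»: `sum_tau_obsW_eq_sum_filter_two_corner_sides` — at a face whose sides `i, i'` meet the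
corner hexagons `y_a, y_b`, the defect formula runs over the pictures reading `a` at `i` and `b` at `i'` only). It transports the second through the first, for every `k`:

* `defectAt_classWt_eq_relMapΦ` — on an INCREASING reading the defect of a pattern class weight is the relation-map value: `defectAt (classWt w) (P.α, P.β, P.γ, P.L₀) = Φ w P`;
  `defectAt_classWt_eq_zero_of_relMapΦ` — a tripod-picture reading `(α, β, γ; L₀)` (any of the three cyclic rotations) has defect `0` as soon as `Φ w` vanishes at the
  increasing representative (bookkeeping over `CcwTriple` with `tripodDefect_rotate_eq_zero_iff`);
* ★★★ `holoLam_eq_of_two_corner_sides` — **THE FACE FUNCTIONAL OF A TWO-CORNER FACE DEPENDS ONLY ON THE COORDINATES OF THE PICTURES THROUGH BOTH CORNERS**: if `θ, θ' ∈ ℂ^{Pic k}`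
  agree at every `P` with `a, b ∈ {P.α, P.β, P.γ}`, then `holoLam D v hv θ = holoLam D v hv θ'`; ★★ `holoLam_eq_zero_of_two_corner_sides` (it vanishes on every `θ` vanishing
  there). With «DOOR-U FORM» this is the statement that the two-corner sub-family of face functionals acts on the quotient `ℂ^{Pic k} / ℂ^{isolated}` only — the
  «isolated-triple» pictures (no two corners adjacent to a common face) are in the common kernel of the whole two-corner family, so door (U) needs the faces with at most one
  corner side exactly for them (HOME `FINDING-TRIPOD-DOOR-U-TWO-CORNER.md`: 0, 0, 3, 22, 117, 550 such pictures for `k = 5, …, 15`).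

## References
* M. Khristoforov, S. Smirnov, *Percolation and O(1) loop model*, arXiv:2111.15612 (2021), §2 Lemma 4, proof and Fig. 3 (arXiv v1 p. 4).
* B. Bollobás, O. Riordan, *Percolation*, CUP (2006), Ch. 7 §7.2.2 (pp. 191–195: marked discrete domains, corner faces).

## Mathlib / tree
Tree: `MarkedLoopNecessityForm.lean` (`holoLam`, `holoDefect_eq_holoLam_relMapΦ`), `MarkedLoopCornerSideSupport.lean` (`PicIdx.ReadsAt`, `sum_tau_obsW_eq_sum_filter_two_corner_sides`),
`MarkedLoopTripodCharacter.lean` (`relMapΦ`, `relMapΦ_apply`, `relMapΦ_surjective`, `holoDefect_apply`, `Pic.loP/midP/hiP`), `MarkedLoopTripodRank.lean` (`Pic`, `Pic.α/β/γ/L₀`, `Pic.pic`),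
`MarkedLoopHolomorphicDefect.lean` (`defectAt`, `tripodDefect`, `tripodDefect_rotate_eq_zero_iff`, `tripodPicture_of_pictureCount_ne_zero`), `MarkedLoopHolomorphy.lean` (`TripodPicture`,
`CcwTriple`, `TripodPicture.rotate`), `MarkedLoopTripodBasis.lean` (`classWt`, `TripodPicture.isPattern_lo`).
-/

namespace Literature.Probability.Percolation.MarkedLoops

open Literature.Probability.Percolation Literature.Probability.LatticeModels
open Literature.Probability.Percolation.FivePoint (tau)
open TriMarkedDomain

section TwoCornerLam

variable {nm : ℕ} {D : TriMarkedDomain nm}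

/-- the class weight of a pattern weight at a genuine pattern is the weight. [cite: KhristoforovSmirnov2021, §2 Definition 3 (arXiv v1 p. 4)] -/
theorem classWt_of_isPattern (w : Pat nm → ℂ) {j : Fin nm} {L : Finset (Fin nm × Fin nm)} (h : IsPattern j L) : classWt w j L = w ⟨(j, L), h⟩ := by
  unfold classWt
  rw [dif_pos h]

/-- ★ **on an increasing reading, the defect of a pattern class weight IS the relation-map value**: `defectAt (classWt w) (P.α, P.β, P.γ, P.L₀) = Φ w P`.
[cite: KhristoforovSmirnov2021, §2 Lemma 4, proof and Fig. 3 (arXiv v1 p. 4)] -/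
theorem defectAt_classWt_eq_relMapΦ (w : Pat nm → ℂ) (P : Pic nm) : defectAt (classWt w) (P.α, P.β, P.γ, P.L₀) = relMapΦ nm w P := by
  rw [relMapΦ_apply]
  show tripodDefect (classWt w) P.α P.β P.γ P.L₀ = _
  unfold tripodDefect
  rw [classWt_of_isPattern w P.pic.isPattern_lo, classWt_of_isPattern w P.pic.rotate.isPattern_lo, classWt_of_isPattern w P.pic.rotate.rotate.isPattern_lo]
  rfl

/-- ★ **a tripod-picture reading has zero defect as soon as `Φ w` vanishes at its increasing representative** (the three cyclic readings of a picture have proportional defects;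
the representative `P` offered to the hypothesis has the same three corners). [cite: KhristoforovSmirnov2021, §2 Lemma 4, proof and Fig. 3 (arXiv v1 p. 4)] -/
theorem defectAt_classWt_eq_zero_of_relMapΦ (w : Pat nm → ℂ) {α β γ : Fin nm} {L₀ : Finset (Fin nm × Fin nm)} (hpic : TripodPicture α β γ L₀)
    (hΦ : ∀ P : Pic nm, (∀ x : Fin nm, (x = α ∨ x = β ∨ x = γ) → (P.α = x ∨ P.β = x ∨ P.γ = x)) → relMapΦ nm w P = 0) :
    defectAt (classWt w) (α, β, γ, L₀) = 0 := by
  rcases hpic.ccw with ⟨h1, h2⟩ | ⟨h1, h2⟩ | ⟨h1, h2⟩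
  · -- increasing as read
    let P : Pic nm := ⟨((α, β, γ), L₀), h1, h2, hpic⟩
    have h := defectAt_classWt_eq_relMapΦ w P
    rw [hΦ P (fun x hx => by rcases hx with rfl | rfl | rfl <;> [exact Or.inl rfl; exact Or.inr (Or.inl rfl); exact Or.inr (Or.inr rfl)])] at h
    exact h
  · -- `β < γ < α`: the rotated reading is increasing
    let P : Pic nm := ⟨((β, γ, α), L₀), h1, h2, hpic.rotate⟩
    have h := defectAt_classWt_eq_relMapΦ w P
    rw [hΦ P (fun x hx => by rcases hx with rfl | rfl | rfl <;> [exact Or.inr (Or.inr rfl); exact Or.inl rfl; exact Or.inr (Or.inl rfl)])] at h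
    exact (tripodDefect_rotate_eq_zero_iff (classWt w) α β γ L₀).1 h
  · -- `γ < α < β`: rotate twice
    let P : Pic nm := ⟨((γ, α, β), L₀), h1, h2, hpic.rotate.rotate⟩
    have h := defectAt_classWt_eq_relMapΦ w P
    rw [hΦ P (fun x hx => by rcases hx with rfl | rfl | rfl <;> [exact Or.inr (Or.inl rfl); exact Or.inr (Or.inr rfl); exact Or.inl rfl])] at h
    exact (tripodDefect_rotate_eq_zero_iff (classWt w) α β γ L₀).1 ((tripodDefect_rotate_eq_zero_iff (classWt w) β γ α L₀).1 h)

/-- reading `a` at some side puts `a` in the triple. [cite: KhristoforovSmirnov2021, §2 Lemma 4 (arXiv v1 p. 4)] -/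
theorem PicIdx.mem_of_readsAt {Q : PicIdx nm} {i : Fin 3} {a : Fin nm} (h : Q.ReadsAt i a) : a = Q.1 ∨ a = Q.2.1 ∨ a = Q.2.2.1 := by
  fin_cases i
  · exact Or.inl (h.1 rfl).symm
  · exact Or.inr (Or.inl (h.2.1 rfl).symm)
  · exact Or.inr (Or.inr (h.2.2 rfl).symm)

/-- ★★ **A TWO-CORNER FACE FUNCTIONAL VANISHES ON EVERY VECTOR VANISHING AT THE PICTURES THROUGH BOTH CORNERS** (for every `k`).
[cite: KhristoforovSmirnov2021, §2 Lemma 4, proof and Fig. 3 (arXiv v1 p. 4); BollobasRiordan2006, Ch. 7 §7.2.2 (pp. 191–195)] -/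
theorem holoLam_eq_zero_of_two_corner_sides {v : HexVertex} (hv : AllSides D v) {i i' : Fin 3} {a b : Fin nm} (ha : oppFace v i = yc D a) (hb : oppFace v i' = yc D b)
    {θ : Pic nm → ℂ} (h : ∀ P : Pic nm, (P.α = a ∨ P.β = a ∨ P.γ = a) → (P.α = b ∨ P.β = b ∨ P.γ = b) → θ P = 0) : holoLam D v hv θ = 0 := by
  classical
  obtain ⟨w, rfl⟩ := relMapΦ_surjective θ
  rw [← holoDefect_eq_holoLam_relMapΦ hv, holoDefect_apply, sum_tau_obsW_eq_sum_filter_two_corner_sides (classWt w) hv ha hb]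
  refine Finset.sum_eq_zero fun Q hQ => ?_
  obtain ⟨hQa, hQb⟩ := (Finset.mem_filter.1 hQ).2
  by_cases hc : pictureCount D v Q = 0
  · rw [hc, Nat.cast_zero, zero_mul]
  have hpic := tripodPicture_of_pictureCount_ne_zero hv hc
  have ha' := PicIdx.mem_of_readsAt hQa
  have hb' := PicIdx.mem_of_readsAt hQb
  obtain ⟨qa, qb, qc, L₀⟩ := Q
  have hz : defectAt (classWt w) (qa, qb, qc, L₀) = 0 :=
    defectAt_classWt_eq_zero_of_relMapΦ w hpic fun P mem => h P (mem a ha') (mem b hb')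
  rw [hz, mul_zero]

/-- ★★★ **THE FACE FUNCTIONAL OF A TWO-CORNER FACE DEPENDS ONLY ON THE COORDINATES OF THE PICTURES THROUGH BOTH CORNERS**: two vectors of `ℂ^{Pic k}` that agree at every
picture `P` with `a, b ∈ {P.α, P.β, P.γ}` have the same value under `holoLam D v` — so the «isolated-triple» coordinates lie in the common kernel of the whole two-corner family,
and by «DOOR-U FORM» door (U) needs the faces with at most one corner side exactly for them. [cite: KhristoforovSmirnov2021, §2 Lemma 4, proof and Fig. 3 (arXiv v1 p. 4); BollobasRiordan2006, Ch. 7 §7.2.2 (pp. 191–195)] -/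
theorem holoLam_eq_of_two_corner_sides {v : HexVertex} (hv : AllSides D v) {i i' : Fin 3} {a b : Fin nm} (ha : oppFace v i = yc D a) (hb : oppFace v i' = yc D b)
    {θ θ' : Pic nm → ℂ} (h : ∀ P : Pic nm, (P.α = a ∨ P.β = a ∨ P.γ = a) → (P.α = b ∨ P.β = b ∨ P.γ = b) → θ P = θ' P) :
    holoLam D v hv θ = holoLam D v hv θ' := by
  rw [← sub_eq_zero, ← map_sub]
  exact holoLam_eq_zero_of_two_corner_sides hv ha hb fun P hPa hPb => by rw [Pi.sub_apply, h P hPa hPb, sub_self]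

end TwoCornerLam

end Literature.Probability.Percolation.MarkedLoops
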